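import Mathlib.LinearAlgebra.FiniteDimensional.Basic
import Mathlib.LinearAlgebra.FiniteDimensional.Lemmas
import Mathlib.LinearAlgebra.Dimension.Finite
import Mathlib.Tactic.Ring
import Mathlib.Tactic.NormNum
import Mathlib.Tactic.Linarith
import HarnessLib

/-!
# NSC(−2) · the kernel shadow of LEMMA LIFT (carver C831 (b), prover 2 gen 34): transverse first-order lifting versus semiregularity —
# five def-free linear-algebra heads

Family `hodge`, b2b cell `hweil` (helper of item stmt-HodgeConjecture-2524; cell target NSC(−2) =
`Ring2.Hypotheses.WeilClassesComponent 3 3 [−2]`). Order LADDER `## CARVER v138` C831 (c) (2′) for pv2-g34: «the kernel shadow of LEMMA LIFT — for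
linear maps `ob : V → W`, `σ : W → U`, `c = σ ∘ ob` over a field: `Submodule.map ob (ker c) ≤ ker σ`; `finrank (range ob) = rank c + (finrank (ker c)
− finrank (ker ob))` (`ker ob ≤ ker c`); `ker σ = ⊥ → ker ob = ker c`; and the two numeric instances `(36, 27, 9 ↦ h¹ ≥ 27 + r_⊥)` and
`(16, 6, 10, 9 ↦ 7, kernel 1)` — ≤ 5 def-free heads generalising `nsc3_test_of_rank_eq`». An `Nsc` file (C807 (d)) with NO `Ring2*` import;
Mathlib + HarnessLib only. Companion of `WeilTypeLadderNscSeedsThree.nsc3_test_of_rank_eq` (the sufficient half: `rank(σ ∘ ob) = dim W` forces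
`σ` injective) — this file is the NECESSARY half.

THE DICTIONARY (C831 (b), seat level; nothing of it is formalised beyond the linear algebra): `X` a member of the `(3,3,[−2])` component, `Z ⊂ X`
an lci subscheme of codimension `3` (or an object `G`, with `Ext²(G,G)` for `H¹(N_Z)`) with class `q·h³ + w`, `w ≠ 0`; `V = H¹(T_X)` (dim `36`),
`W = H¹(N_Z)`, `U = H⁴(Ω²_X)`; `ob : V → W` the first-order obstruction to lifting `Z`, `σ : W → U` the semiregularity map, `c = σ ∘ ob` = contraction
with `[Z]` (Bloch's compatibility), `rank c = 27`, `ker c = T_Weil` (dim `9`), `L(Z) := ker ob` (the directions along which `Z` lifts to first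
order), `r_⊥ := dim ker c − dim ker ob = 9 − dim L(Z)`.
* `nsc_lift_obstructed_direction` — (i): `ob(ker c) ⊆ ker σ`; ONE direction `ξ ∈ ker c` with `ob ξ ≠ 0` (a Weil direction along which `Z` does
  not lift) makes `σ` non-injective: `Z` is NOT semiregular — K7's closing datum from first-order data alone.
* `nsc_lift_rank` — (ii): `ker ob ≤ ker c`, `dim range ob + dim ker ob = dim range c + dim ker c (= dim V)`, hence
  `h¹(N_Z) = dim W ≥ dim range ob = rank c + r_⊥`: the 27-TEST `h¹(N_Z) = 27` needs `r_⊥ = 0`.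
* `nsc_lift_ker_eq_of_semiregular` — the contrapositive in its clean form: `ker σ = ⊥ → ker ob = ker c` (a semiregular `Z` lifts to first order
  along EVERY direction keeping its class Hodge, `L(Z) = T_Weil`).
* `nsc_lift_kernel_of_lt` — `dim U < dim W → ker σ ≠ ⊥` (the Jacobian instance: `σ : H¹(N_C) ≅ k⁷ → H⁴(Ω²_J) ≅ k⁶` has a kernel).
* `nsc_lift_instances` — the two numeric instances: H-27 (`dim V = 36`, `rank c = 27`, `dim ker c = 9`, `dim L = 9 − r_⊥` ⟹
  `rank ob = 36 − dim L = 27 + r_⊥`, and `h¹ = 27 ⟹ r_⊥ = 0`) and the genus-4 Jacobian (`16, 6, 10, 9 ⟹ rank ob = 7 = 6 + 1`, kernel `≥ 1`).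

HONEST FRAMING: elementary linear algebra named by the cell lead to fix the ORDER of H-27's test data (`r_⊥` first, `h¹(N_Z)` second); nothing
here is a rung, a candidate or evidence for NSC(−2); LEMMA LIFT's geometric inputs (Bloch's compatibility `c = σ ∘ ob`, `rank c = 27`,
flatness over the habitat) are NOT formalised and NOT cited as facts; no statement of [Markman 2025] / [Perry 2026] is used; `HC_CM` occurs
nowhere. [cite: Bloch1972Semiregularity, §6–§7 (compatibility of the obstruction with the semiregularity map)] [cite: BuchweitzFlenner2003, Thm. 5.2]
-/

-- mandated namespace `Summit.HodgeConjecture.HodgeConjecture.…` (Problem = Summit) trips `linter.dupNamespace`; the lakefile disables it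
-- tree-wide (weak option), restated here so stand-alone elaboration is warning-free too.
set_option linter.dupNamespace false

namespace Summit.HodgeConjecture.HodgeConjecture.WeilTypeLadder

section NscLift

variable {F V W U : Type*} [Field F] [AddCommGroup V] [Module F V] [AddCommGroup W] [Module F W]
  [AddCommGroup U] [Module F U]

open Module LinearMap

/-- **LEMMA LIFT (i).** For `c = σ ∘ ob`: `ob(ker c) ⊆ ker σ`, and a single `ξ` with `c ξ = 0`, `ob ξ ≠ 0` (a Weil direction along which `Z`
does not lift to first order) shows `ker σ ≠ ⊥` — the semiregularity map is not injective, `Z` is not Bloch-semiregular.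
[cite: Bloch1972Semiregularity, §6–§7] -/
theorem nsc_lift_obstructed_direction (ob : V →ₗ[F] W) (σ : W →ₗ[F] U) :
    Submodule.map ob (ker (σ ∘ₗ ob)) ≤ ker σ ∧
    ((∃ ξ : V, σ (ob ξ) = 0 ∧ ob ξ ≠ 0) → ker σ ≠ ⊥) := by
  constructor
  · rintro w ⟨v, hv, rfl⟩
    simpa [mem_ker] using hv
  · rintro ⟨ξ, hc, hne⟩ hbot
    have : ob ξ ∈ ker σ := by simpa [mem_ker] using hc
    rw [hbot, Submodule.mem_bot] at this
    exact hne this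

/-- **LEMMA LIFT (ii).** `ker ob ≤ ker (σ ∘ ob)`; rank–nullity for `ob` and for `c = σ ∘ ob` on the same finite-dimensional source; hence
`dim W ≥ dim range ob = rank c + (dim ker c − dim ker ob) = rank c + r_⊥` — the 27-TEST (`dim W = rank c`) can pass only if `r_⊥ = 0`.
[cite: BuchweitzFlenner2003, Thm. 5.2] -/
theorem nsc_lift_rank [FiniteDimensional F V] [FiniteDimensional F W] (ob : V →ₗ[F] W) (σ : W →ₗ[F] U) :
    ker ob ≤ ker (σ ∘ₗ ob) ∧
    finrank F (ker ob) ≤ finrank F (ker (σ ∘ₗ ob)) ∧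
    finrank F (range ob) + finrank F (ker ob) = finrank F (range (σ ∘ₗ ob)) + finrank F (ker (σ ∘ₗ ob)) ∧
    finrank F (range ob) = finrank F (range (σ ∘ₗ ob)) + (finrank F (ker (σ ∘ₗ ob)) - finrank F (ker ob)) ∧
    finrank F (range (σ ∘ₗ ob)) + (finrank F (ker (σ ∘ₗ ob)) - finrank F (ker ob)) ≤ finrank F W := by
  have hle : ker ob ≤ ker (σ ∘ₗ ob) := ker_le_ker_comp ob σ
  have hmono : finrank F (ker ob) ≤ finrank F (ker (σ ∘ₗ ob)) := Submodule.finrank_mono hle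
  have h1 := finrank_range_add_finrank_ker ob
  have h2 := finrank_range_add_finrank_ker (σ ∘ₗ ob)
  have hW : finrank F (range ob) ≤ finrank F W := Submodule.finrank_le _
  refine ⟨hle, hmono, by omega, by omega, by omega⟩

/-- **LEMMA LIFT, contrapositive of (i).** If the semiregularity map is injective (`ker σ = ⊥`) then `ker ob = ker (σ ∘ ob)`: a semiregular `Z` lifts
to first order along every direction that keeps its class Hodge (`L(Z) = T_Weil`, `r_⊥ = 0`). [cite: Bloch1972Semiregularity, §6–§7] -/
theorem nsc_lift_ker_eq_of_semiregular (ob : V →ₗ[F] W) (σ : W →ₗ[F] U) (hσ : ker σ = ⊥) :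
    ker ob = ker (σ ∘ₗ ob) :=
  (ker_comp_of_ker_eq_bot ob hσ).symm

/-- **LEMMA LIFT (iv), the dimension count.** A linear map to a space of smaller dimension has a kernel: `dim U < dim W → ker σ ≠ ⊥` (the genus-4
Jacobian: `σ : H¹(N_C) ≅ k⁷ → H⁴(Ω²_J) ≅ k⁶` is not injective, `C ⊂ J(C)` is not semiregular). [folklore] -/
theorem nsc_lift_kernel_of_lt [FiniteDimensional F W] [FiniteDimensional F U] (σ : W →ₗ[F] U)
    (h : finrank F U < finrank F W) : ker σ ≠ ⊥ :=
  ker_ne_bot_of_finrank_lt h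

/-- **LEMMA LIFT, the two numeric instances.** (H-27) `dim V = 36`, `rank c = 27`, `dim ker c = 9 = 36 − 27`, `dim L(Z) = L ≤ 9`, `r_⊥ = 9 − L`:
`rank ob = 36 − L = 27 + r_⊥`, so `h¹(N_Z) ≥ 27 + r_⊥` and `h¹(N_Z) = 27 ⟹ r_⊥ = 0 ⟹ L = 9`. (Jacobian, `g = 4`) `dim V = 16`, `rank c = 6`,
`dim ker c = 10`, `L(C) = 9`: `r_⊥ = 1`, `rank ob = 16 − 9 = 7 = 6 + 1`, and `h¹(N_C) = 7 > 6 = dim U`. [folklore] -/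
theorem nsc_lift_instances :
    (∀ L h1 : ℕ, L ≤ 9 → 36 - L = 27 + (9 - L) ∧ (27 + (9 - L) ≤ h1 → h1 = 27 → 9 - L = 0 ∧ L = 9)) ∧
    ((36 : ℕ) - 27 = 9 ∧ (16 : ℕ) - 6 = 10 ∧ (10 : ℕ) - 9 = 1 ∧ (16 : ℕ) - 9 = 7 ∧ (7 : ℕ) = 6 + 1 ∧ (6 : ℕ) < 7) := by
  refine ⟨fun L h1 hL => ⟨by omega, fun hle h27 => by omega⟩, by norm_num⟩

end NscLift

end Summit.HodgeConjecture.HodgeConjecture.WeilTypeLadder
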